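import Mathlib.Analysis.SpecialFunctions.Exponential
import Mathlib.LinearAlgebra.Matrix.PosDef
import Literature.MathematicalPhysics.QuantumLattice.SpinOperators
import HarnessLib

/-!
# Discharges for `SpinOperators`: commutation relations and the axis rotations

Trunk T-QLATTICE. Sibling proof file of
`Literature/MathematicalPhysics/QuantumLattice/SpinOperators.lean` (no statement of that file is
changed; this file only proves). Contents:

* the ladder-operator identities `[S⁺, S⁻] = 2 Sᶻ`, `[Sᶻ, S⁺] = S⁺`, `[Sᶻ, S⁻] = -S⁻` for every
  spin `S = n/2` (entrywise, from `spinRaise_apply`);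
* `spin_commutation_holds n : spin_commutation n`, the discharge of the named fact
  `[Sˣ, Sʸ] = i Sᶻ`, `[Sʸ, Sᶻ] = i Sˣ`, `[Sᶻ, Sˣ] = i Sʸ` (Tasaki (2020) §2.1, eq. (2.1.1));
* `spinRotation_mem_unitaryGroup_holds n : spinRotation_mem_unitaryGroup n` (`exp(-iθ·𝐒)` is
  unitary, `θ·𝐒` being Hermitian; Tasaki (2020) eq. (2.1.10));
* `spinCasimir_eq_holds n : spinCasimir_eq n`, the discharge of the named fact `𝐒² = S(S+1)𝟙`
  (Tasaki (2020) §2.1, eq. (2.1.2)), via `(Sˣ)² + (Sʸ)² = ½(S⁺S⁻ + S⁻S⁺)` and the diagonal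
  entries `(k+1)(n-k)`, `k(n-k+1)`, `(n/2-k)²` of `S⁺S⁻`, `S⁻S⁺`, `(Sᶻ)²`;
* the two axis rotations used by symmetry arguments for spin Hamiltonians (Kennedy–Lieb–Shastry
  1988; Kubo 1988; Tasaki (2020) §2.1, eqs. (2.1.11)–(2.1.13), (2.1.23)):
  the diagonal phase `D = diag((-i)^k)` (a rotation by `π/2` about the `3`-axis up to a phase)
  with `D Sˣ Dᴴ = -Sʸ`, `D Sʸ Dᴴ = Sˣ`, `D Sᶻ Dᴴ = Sᶻ`, and the rotation by `π/2` about the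
  `2`-axis `V = spinRotation n (Pi.single 1 (π/2)) = exp(-i(π/2)Sʸ)` with `V Sᶻ Vᴴ = Sˣ`,
  `V Sˣ Vᴴ = -Sᶻ`, `V Sʸ Vᴴ = Sʸ` (proved without differentiating: `T = Sᶻ ± i Sˣ` are
  `ad(Sʸ)`-eigenvectors, `[Sʸ, T] = ± T`, so `exp(-cSʸ) T exp(cSʸ) = e^{∓c} T` by Mathlib's
  `SemiconjBy.exp_right`);
* consequences: `-S ≤ Sᵅ ≤ S` and `(Sᵅ)² ≤ S²` in the Loewner order for `α = x, y, z`
  (`posSemidef_smul_one_sub_spinVec`, `posSemidef_smul_one_add_spinVec`,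
  `posSemidef_sq_smul_one_sub_spinVec_sq`), the a priori bounds behind `|⟨Sᵅ_x Sᵅ_y⟩| ≤ S²`.

## Sources

H. Tasaki, *Physics and Mathematics of Quantum Many-Body Systems* (Springer, 2020), §2.1,
eqs. (2.1.1)–(2.1.13); A. Messiah, *Quantum Mechanics* II, ch. XIII §§4–6 (angular momentum,
`J±`, rotation of the components of a vector operator). All statements are finite-dimensional
matrix algebra. [folklore]
-/

noncomputable section

open Matrix Complex

namespace Literature.MathematicalPhysics.QuantumLattice

section QLattice

variable (n : ℕ)

/-! ### Ladder operators -/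

/-- Entries of `S⁻ = (S⁺)ᴴ`: `⟨k| S⁻ |l⟩ = √((l+1)(n-l))` if `k = l + 1`, else `0`.
Tasaki (2020) §2.1, eq. (2.1.6). [folklore] -/
lemma spinLower_apply (k l : Fin (n + 1)) :
    spinLower n k l =
      if k.val = l.val + 1 then (Real.sqrt ((l.val + 1 : ℝ) * (n - l.val : ℝ)) : ℂ) else 0 := by
  rw [spinLower, conjTranspose_apply, spinRaise_apply]
  split_ifs <;> simp [Complex.conj_ofReal]

/-- `S⁺ S⁻` is diagonal with entries `(k+1)(n-k)` (`= S(S+1) - m(m-1)`, `m = n/2 - k`).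
Tasaki (2020) §2.1, eq. (2.1.7). [folklore] -/
lemma spinRaise_mul_spinLower_apply (k l : Fin (n + 1)) :
    (spinRaise n * spinLower n) k l =
      if k = l then (((k.val + 1 : ℝ) * (n - k.val : ℝ) : ℝ) : ℂ) else 0 := by
  rw [mul_apply]
  by_cases hk : k.val + 1 ≤ n
  · -- the only contributing intermediate state is `m = k + 1`
    let m : Fin (n + 1) := ⟨k.val + 1, by omega⟩
    have hm : m.val = k.val + 1 := rfl
    rw [Finset.sum_eq_single m]
    · rw [spinRaise_apply, spinLower_apply, if_pos hm]
      by_cases hkl : k = l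
      · subst hkl
        rw [if_pos hm, if_pos rfl, ← Complex.ofReal_mul, Real.mul_self_sqrt]
        have : (k.val : ℝ) ≤ n := by exact_mod_cast (Nat.lt_succ_iff.mp k.isLt)
        nlinarith
      · have hl : ¬ (m.val = l.val + 1) := fun h => hkl (Fin.ext (by omega))
        rw [if_neg hl, if_neg hkl, mul_zero]
    · intro b _ hb
      rw [spinRaise_apply]
      have : ¬ (b.val = k.val + 1) := fun h => hb (Fin.ext (by rw [hm]; exact h))
      rw [if_neg this, zero_mul]
    · simp
  · -- `k = n`: the row of `S⁺` vanishes and `(k+1)(n-k) = 0`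
    have hkn : k.val = n := by omega
    rw [Finset.sum_eq_zero]
    · split_ifs
      · rw [hkn]
        simp
      · rfl
    · intro b _
      rw [spinRaise_apply]
      have : ¬ (b.val = k.val + 1) := fun h => by omega
      simp [this]

/-- `S⁻ S⁺` is diagonal with entries `k(n-k+1)` (`= S(S+1) - m(m+1)`, `m = n/2 - k`).
Tasaki (2020) §2.1, eq. (2.1.7). [folklore] -/
lemma spinLower_mul_spinRaise_apply (k l : Fin (n + 1)) :
    (spinLower n * spinRaise n) k l =
      if k = l then (((k.val : ℝ) * (n - k.val + 1 : ℝ) : ℝ) : ℂ) else 0 := by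
  rw [mul_apply]
  by_cases hk : 1 ≤ k.val
  · let m : Fin (n + 1) := ⟨k.val - 1, by omega⟩
    have hm : k.val = m.val + 1 := by change k.val = (k.val - 1) + 1; omega
    rw [Finset.sum_eq_single m]
    · rw [spinRaise_apply, spinLower_apply, if_pos hm]
      by_cases hkl : k = l
      · subst hkl
        rw [if_pos hm, if_pos rfl, ← Complex.ofReal_mul, Real.mul_self_sqrt]
        · have e1 : ((m.val : ℝ) + 1) = k.val := by
            have : m.val + 1 = k.val := by omega
            exact_mod_cast this
          have e2 : ((n : ℝ) - m.val) = n - k.val + 1 := by linarith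
          rw [e1, e2]
        · have : (m.val : ℝ) + 1 ≤ n := by
            have h' : m.val + 1 ≤ n := by omega
            exact_mod_cast h'
          nlinarith
      · have hl : ¬ (l.val = m.val + 1) := fun h => hkl (Fin.ext (by omega))
        rw [if_neg hl, if_neg hkl, mul_zero]
    · intro b _ hb
      rw [spinLower_apply]
      have : ¬ (k.val = b.val + 1) := fun h => hb (Fin.ext (by omega))
      rw [if_neg this, zero_mul]
    · simp
  · have hk0 : k.val = 0 := by omega
    rw [Finset.sum_eq_zero]
    · split_ifs
      · rw [hk0]
        simp
      · rfl
    · intro b _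
      rw [spinLower_apply]
      have : ¬ (k.val = b.val + 1) := fun h => by omega
      simp [this]

/-- **`[S⁺, S⁻] = 2 Sᶻ`.** Tasaki (2020) §2.1, eq. (2.1.7); Messiah XIII.(24). [folklore] -/
theorem spinRaise_commutator_spinLower :
    spinRaise n * spinLower n - spinLower n * spinRaise n = (2 : ℂ) • SpinOperators.spinZ n := by
  ext k l
  rw [Matrix.sub_apply, spinRaise_mul_spinLower_apply, spinLower_mul_spinRaise_apply,
    Matrix.smul_apply, spinZ_apply]
  split_ifs with h
  · simp only [smul_eq_mul]
    push_cast
    ring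
  · simp

/-- **`[Sᶻ, S⁺] = S⁺`.** Tasaki (2020) §2.1, eq. (2.1.7); Messiah XIII.(23). [folklore] -/
theorem spinZ_commutator_spinRaise :
    SpinOperators.spinZ n * spinRaise n - spinRaise n * SpinOperators.spinZ n = spinRaise n := by
  ext k l
  rw [Matrix.sub_apply, SpinOperators.spinZ, diagonal_mul, mul_diagonal, spinRaise_apply]
  split_ifs with h
  · have : (l : ℂ) = (k : ℂ) + 1 := by
      have : ((l.val : ℕ) : ℂ) = ((k.val : ℕ) : ℂ) + 1 := by exact_mod_cast h
      simpa using this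
    rw [this]
    ring
  · simp

/-- **`[Sᶻ, S⁻] = -S⁻`** (adjoint of `[Sᶻ, S⁺] = S⁺`). Tasaki (2020) §2.1, eq. (2.1.7).
[folklore] -/
theorem spinZ_commutator_spinLower :
    SpinOperators.spinZ n * spinLower n - spinLower n * SpinOperators.spinZ n = -spinLower n := by
  have h := congrArg conjTranspose (spinZ_commutator_spinRaise n)
  have hz : (SpinOperators.spinZ n)ᴴ = SpinOperators.spinZ n := (spinVec_isHermitian n 2).eq
  rw [conjTranspose_sub, conjTranspose_mul, conjTranspose_mul, hz] at h
  rw [spinLower, ← neg_sub, h]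

/-! ### The commutation relations `[Sᵃ, Sᵇ] = i ε_{abc} Sᶜ` -/

/-- `[Sˣ, Sʸ] = i Sᶻ`. Tasaki (2020) §2.1, eq. (2.1.1). [folklore] -/
theorem lie_spinX_spinY : ⁅spinX n, spinY n⁆ = I • SpinOperators.spinZ n := by
  rw [Ring.lie_def, spinX, spinY, smul_mul_smul_comm, smul_mul_smul_comm,
    mul_comm (1 / (2 * I)) (1 / 2), ← smul_sub]
  have key : (spinRaise n + spinLower n) * (spinRaise n - spinLower n) -
      (spinRaise n - spinLower n) * (spinRaise n + spinLower n) =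
      -((2 : ℂ) • (spinRaise n * spinLower n - spinLower n * spinRaise n)) := by
    simp only [mul_sub, mul_add, sub_mul, add_mul, two_smul]
    abel
  rw [key, spinRaise_commutator_spinLower, smul_neg, smul_smul, smul_smul, ← neg_smul]
  congr 1
  have hI : (I : ℂ) ≠ 0 := I_ne_zero
  field_simp
  ring_nf
  rw [I_sq]

/-- `[Sʸ, Sᶻ] = i Sˣ`. Tasaki (2020) §2.1, eq. (2.1.1). [folklore] -/
theorem lie_spinY_spinZ : ⁅spinY n, SpinOperators.spinZ n⁆ = I • spinX n := by
  rw [Ring.lie_def, spinY, spinX, smul_mul_assoc, mul_smul_comm, ← smul_sub, smul_smul]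
  have key : (spinRaise n - spinLower n) * SpinOperators.spinZ n - SpinOperators.spinZ n * (spinRaise n - spinLower n) =
      -(SpinOperators.spinZ n * spinRaise n - spinRaise n * SpinOperators.spinZ n) +
        (SpinOperators.spinZ n * spinLower n - spinLower n * SpinOperators.spinZ n) := by
    simp only [mul_sub, sub_mul]
    abel
  rw [key, spinZ_commutator_spinRaise, spinZ_commutator_spinLower, ← neg_add, smul_neg,
    ← neg_smul]
  congr 1
  have hI : (I : ℂ) ≠ 0 := I_ne_zero
  field_simp
  ring_nf
  rw [I_sq]

/-- `[Sᶻ, Sˣ] = i Sʸ`. Tasaki (2020) §2.1, eq. (2.1.1). [folklore] -/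
theorem lie_spinZ_spinX : ⁅SpinOperators.spinZ n, spinX n⁆ = I • spinY n := by
  rw [Ring.lie_def, spinX, spinY, smul_mul_assoc, mul_smul_comm, ← smul_sub, smul_smul]
  have key : SpinOperators.spinZ n * (spinRaise n + spinLower n) - (spinRaise n + spinLower n) * SpinOperators.spinZ n =
      (SpinOperators.spinZ n * spinRaise n - spinRaise n * SpinOperators.spinZ n) +
        (SpinOperators.spinZ n * spinLower n - spinLower n * SpinOperators.spinZ n) := by
    simp only [mul_add, add_mul]
    abel
  rw [key, spinZ_commutator_spinRaise, spinZ_commutator_spinLower, ← sub_eq_add_neg]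
  congr 1
  have hI : (I : ℂ) ≠ 0 := I_ne_zero
  field_simp

/-- **Discharge of `spin_commutation`**: `[Sᵃ, Sᵃ⁺¹] = i Sᵃ⁺²` for `a ∈ ℤ/3`, i.e.
`[Sˣ, Sʸ] = i Sᶻ`, `[Sʸ, Sᶻ] = i Sˣ`, `[Sᶻ, Sˣ] = i Sʸ`, for every spin `S = n/2`.
Tasaki (2020) §2.1, eq. (2.1.1). [folklore] -/
theorem spin_commutation_holds : spin_commutation n := by
  intro a
  fin_cases a
  · exact lie_spinX_spinY n
  · exact lie_spinY_spinZ n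
  · exact lie_spinZ_spinX n

/-! ### Rotations are unitary -/

/-- `θ·𝐒 = Σ_α θ_α Sᵅ` is Hermitian for real `θ`. Tasaki (2020) §2.1. [folklore] -/
theorem isHermitian_sum_smul_spinVec (θ : Fin 3 → ℝ) :
    (∑ α : Fin 3, (θ α : ℂ) • spinVec n α).IsHermitian := by
  rw [IsHermitian, conjTranspose_sum]
  refine Finset.sum_congr rfl fun α _ => ?_
  rw [conjTranspose_smul, (spinVec_isHermitian n α).eq]
  simp

set_option backward.isDefEq.respectTransparency false in
/-- `exp(-i H)` is unitary for Hermitian `H` (`-iH` is skew-adjoint; Mathlib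
`NormedSpace.exp_mem_unitary_of_mem_skewAdjoint`). Tasaki (2020) §2.1, eq. (2.1.10). [folklore] -/
theorem exp_neg_I_smul_mem_unitaryGroup {m : Type*} [Fintype m] [DecidableEq m]
    {H : Matrix m m ℂ} (hH : H.IsHermitian) :
    NormedSpace.exp ((-I) • H) ∈ Matrix.unitaryGroup m ℂ := by
  have hskew : (-I) • H ∈ skewAdjoint (Matrix m m ℂ) := by
    rw [skewAdjoint.mem_iff, star_eq_conjTranspose, conjTranspose_smul, hH.eq]
    simp
  open scoped Matrix.Norms.Operator in exact NormedSpace.exp_mem_unitary_of_mem_skewAdjoint hskew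

/-- **Discharge of `spinRotation_mem_unitaryGroup`**: `U(θ) = exp(-iθ·𝐒)` is unitary.
Tasaki (2020) §2.1, eq. (2.1.10). [folklore] -/
theorem spinRotation_mem_unitaryGroup_holds : spinRotation_mem_unitaryGroup n := fun θ =>
  exp_neg_I_smul_mem_unitaryGroup (isHermitian_sum_smul_spinVec n θ)

/-! ### The rotation about the `2`-axis: `ad(Sʸ)`-eigenoperators -/

/-- `T = Sᶻ + i Sˣ` is an `ad(Sʸ)`-eigenoperator: `[Sʸ, T] = T`, written as
`T Sʸ = (Sʸ - 1) T`. Messiah XIII §6 (vector operators). [folklore] -/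
theorem semiconjBy_spinZ_add_I_smul_spinX :
    SemiconjBy (SpinOperators.spinZ n + I • spinX n) (spinY n) (spinY n - 1) := by
  have h1 : spinY n * SpinOperators.spinZ n - SpinOperators.spinZ n * spinY n = I • spinX n := lie_spinY_spinZ n
  have h2 : spinX n * spinY n - spinY n * spinX n = I • SpinOperators.spinZ n := lie_spinX_spinY n
  rw [SemiconjBy, add_mul, sub_mul, one_mul, mul_add, smul_mul_assoc, mul_smul_comm]
  -- goal: Sᶻ Sʸ + I • (Sˣ Sʸ) = Sʸ Sᶻ + I • (Sʸ Sˣ) - (Sᶻ + I • Sˣ)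
  have h1' : SpinOperators.spinZ n * spinY n = spinY n * SpinOperators.spinZ n - I • spinX n := by
    rw [← h1]; abel
  have h2' : spinX n * spinY n = spinY n * spinX n + I • SpinOperators.spinZ n := by
    rw [← h2]; abel
  rw [h1', h2', smul_add, smul_smul, I_mul_I, neg_one_smul]
  abel

/-- `T' = Sᶻ - i Sˣ` satisfies `[Sʸ, T'] = -T'`, i.e. `T' Sʸ = (Sʸ + 1) T'`.
Messiah XIII §6. [folklore] -/
theorem semiconjBy_spinZ_sub_I_smul_spinX :
    SemiconjBy (SpinOperators.spinZ n - I • spinX n) (spinY n) (spinY n + 1) := by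
  have h1 : spinY n * SpinOperators.spinZ n - SpinOperators.spinZ n * spinY n = I • spinX n := lie_spinY_spinZ n
  have h2 : spinX n * spinY n - spinY n * spinX n = I • SpinOperators.spinZ n := lie_spinX_spinY n
  rw [SemiconjBy, sub_mul, add_mul, one_mul, mul_sub, smul_mul_assoc, mul_smul_comm]
  have h1' : SpinOperators.spinZ n * spinY n = spinY n * SpinOperators.spinZ n - I • spinX n := by
    rw [← h1]; abel
  have h2' : spinX n * spinY n = spinY n * spinX n + I • SpinOperators.spinZ n := by
    rw [← h2]; abel
  rw [h1', h2', smul_add, smul_smul, I_mul_I, neg_one_smul]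
  abel

/-- `exp(c Sʸ) exp(-c Sʸ) = 1`. [folklore] -/
theorem exp_smul_spinY_mul_exp_neg (c : ℂ) :
    NormedSpace.exp (c • spinY n) * NormedSpace.exp (-(c • spinY n)) = 1 := by
  rw [← Matrix.exp_add_of_commute _ _ ((Commute.refl (c • spinY n)).neg_right),
    add_neg_cancel, NormedSpace.exp_zero]

/-- `exp(-c Sʸ) exp(c Sʸ) = 1`. [folklore] -/
theorem exp_neg_mul_exp_smul_spinY (c : ℂ) :
    NormedSpace.exp (-(c • spinY n)) * NormedSpace.exp (c • spinY n) = 1 := by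
  rw [← Matrix.exp_add_of_commute _ _ ((Commute.refl (c • spinY n)).neg_left),
    neg_add_cancel, NormedSpace.exp_zero]

set_option backward.isDefEq.respectTransparency false in
/-- The scalar exponential inside the matrix algebra: `exp(a • 1) = e^a • 1`. [folklore] -/
theorem exp_smul_one_eq {m : Type*} [Fintype m] [DecidableEq m] (a : ℂ) :
    NormedSpace.exp (a • (1 : Matrix m m ℂ)) = Complex.exp a • (1 : Matrix m m ℂ) := by
  have h : algebraMap ℂ (Matrix m m ℂ) (NormedSpace.exp a) =
      NormedSpace.exp (algebraMap ℂ (Matrix m m ℂ) a) :=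
    open scoped Matrix.Norms.Operator in NormedSpace.algebraMap_exp_comm a
  rw [Algebra.algebraMap_eq_smul_one, Algebra.algebraMap_eq_smul_one] at h
  rw [Complex.exp_eq_exp_ℂ]
  exact h.symm

set_option backward.isDefEq.respectTransparency false in
/-- **Rotation of the eigenoperator `T = Sᶻ + i Sˣ`**:
`exp(c Sʸ) T exp(-c Sʸ) = e^{c} T` for every `c ∈ ℂ` (from `[Sʸ, T] = T` and Mathlib's
`SemiconjBy.exp_right`; no differentiation). Messiah XIII §6, eq. (XIII.60). [folklore] -/
theorem exp_spinY_conj_spinZ_add_I_smul_spinX (c : ℂ) :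
    NormedSpace.exp (c • spinY n) * (SpinOperators.spinZ n + I • spinX n) * NormedSpace.exp (-(c • spinY n)) =
      Complex.exp c • (SpinOperators.spinZ n + I • spinX n) := by
  set T := SpinOperators.spinZ n + I • spinX n with hT
  set E := NormedSpace.exp (c • spinY n) with hE
  set E' := NormedSpace.exp (-(c • spinY n)) with hE'
  -- `T E = exp(c (Sʸ - 1)) T = e^{-c} E T`
  have hsc : SemiconjBy T (c • spinY n) (c • (spinY n - 1)) :=
    (semiconjBy_spinZ_add_I_smul_spinX n).smul_right c
  have hexp : T * E = NormedSpace.exp (c • (spinY n - 1)) * T := by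
    open scoped Matrix.Norms.Operator in exact hsc.exp_right
  have hsplit : NormedSpace.exp (c • (spinY n - 1)) = Complex.exp (-c) • E := by
    have hcomm : Commute (c • spinY n) ((-c) • (1 : Matrix (Fin (n + 1)) (Fin (n + 1)) ℂ)) :=
      ((Commute.one_right (spinY n)).smul_right (-c)).smul_left c
    rw [smul_sub, sub_eq_add_neg, ← neg_smul, Matrix.exp_add_of_commute _ _ hcomm, exp_smul_one_eq,
      mul_smul_comm, mul_one]
  rw [hsplit] at hexp
  -- multiply `T E = e^{-c} E T` on the right by `E'`
  have h := congrArg (· * E') hexp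
  simp only [mul_assoc, smul_mul_assoc] at h
  rw [hE, hE', exp_smul_spinY_mul_exp_neg, mul_one, ← hE, ← hE'] at h
  -- `h : T = e^{-c} • (E * (T * E'))`
  have hc : Complex.exp c * Complex.exp (-c) = 1 := by
    rw [← Complex.exp_add, add_neg_cancel, Complex.exp_zero]
  calc E * T * E' = (Complex.exp c * Complex.exp (-c)) • (E * (T * E')) := by
        rw [hc, one_smul, mul_assoc]
    _ = Complex.exp c • T := by rw [← smul_smul, ← h]

set_option backward.isDefEq.respectTransparency false in
/-- **Rotation of `T' = Sᶻ - i Sˣ`**: `exp(c Sʸ) T' exp(-c Sʸ) = e^{-c} T'`.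
Messiah XIII §6. [folklore] -/
theorem exp_spinY_conj_spinZ_sub_I_smul_spinX (c : ℂ) :
    NormedSpace.exp (c • spinY n) * (SpinOperators.spinZ n - I • spinX n) * NormedSpace.exp (-(c • spinY n)) =
      Complex.exp (-c) • (SpinOperators.spinZ n - I • spinX n) := by
  set T := SpinOperators.spinZ n - I • spinX n with hT
  set E := NormedSpace.exp (c • spinY n) with hE
  set E' := NormedSpace.exp (-(c • spinY n)) with hE'
  have hsc : SemiconjBy T (c • spinY n) (c • (spinY n + 1)) :=
    (semiconjBy_spinZ_sub_I_smul_spinX n).smul_right c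
  have hexp : T * E = NormedSpace.exp (c • (spinY n + 1)) * T := by
    open scoped Matrix.Norms.Operator in exact hsc.exp_right
  have hsplit : NormedSpace.exp (c • (spinY n + 1)) = Complex.exp c • E := by
    have hcomm : Commute (c • spinY n) (c • (1 : Matrix (Fin (n + 1)) (Fin (n + 1)) ℂ)) :=
      ((Commute.one_right (spinY n)).smul_right c).smul_left c
    rw [smul_add, Matrix.exp_add_of_commute _ _ hcomm, exp_smul_one_eq, mul_smul_comm, mul_one]
  rw [hsplit] at hexp
  have h := congrArg (· * E') hexp
  simp only [mul_assoc, smul_mul_assoc] at h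
  rw [hE, hE', exp_smul_spinY_mul_exp_neg, mul_one, ← hE, ← hE'] at h
  have hc : Complex.exp (-c) * Complex.exp c = 1 := by
    rw [← Complex.exp_add, neg_add_cancel, Complex.exp_zero]
  calc E * T * E' = (Complex.exp (-c) * Complex.exp c) • (E * (T * E')) := by
        rw [hc, one_smul, mul_assoc]
    _ = Complex.exp (-c) • T := by rw [← smul_smul, ← h]

/-! ### The rotation by `π/2` about the `2`-axis maps `Sᶻ ↦ Sˣ ↦ -Sᶻ` -/

/-- A rotation vector along the `2`-axis: `spinRotation n (0, θ, 0) = exp(-iθ Sʸ)`.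
Tasaki (2020) §2.1, eq. (2.1.10). [folklore] -/
theorem spinRotation_single_one (θ : ℝ) :
    spinRotation n (Pi.single 1 θ) = NormedSpace.exp ((-I * (θ : ℂ)) • spinY n) := by
  rw [spinRotation, Fin.sum_univ_three]
  have h0 : ((Pi.single 1 θ : Fin 3 → ℝ) 0 : ℝ) = 0 := by simp
  have h1 : ((Pi.single 1 θ : Fin 3 → ℝ) 1 : ℝ) = θ := by simp
  have h2 : ((Pi.single 1 θ : Fin 3 → ℝ) 2 : ℝ) = 0 := by simp
  rw [h0, h1, h2]
  simp only [Complex.ofReal_zero, zero_smul, zero_add, add_zero, spinVec_one, smul_smul]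

/-- The adjoint of `exp(c Sʸ)` for imaginary `c = -iθ` is `exp(-c Sʸ)`. [folklore] -/
theorem conjTranspose_exp_spinY (θ : ℝ) :
    (NormedSpace.exp ((-I * (θ : ℂ)) • spinY n))ᴴ =
      NormedSpace.exp (-((-I * (θ : ℂ)) • spinY n)) := by
  have hY : (spinY n)ᴴ = spinY n := (spinVec_isHermitian n 1).eq
  rw [← Matrix.exp_conjTranspose, conjTranspose_smul, hY]
  congr 1
  rw [← neg_smul]
  congr 1
  simp [Complex.conj_ofReal]

/-- `e^{-iπ/2} = -i`. [folklore] -/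
theorem cexp_neg_I_mul_pi_div_two : Complex.exp (-I * ((Real.pi / 2 : ℝ) : ℂ)) = -I := by
  rw [show -I * ((Real.pi / 2 : ℝ) : ℂ) = (-(Real.pi / 2 : ℂ)) * I by push_cast; ring,
    Complex.exp_mul_I, Complex.cos_neg, Complex.sin_neg, Complex.cos_pi_div_two,
    Complex.sin_pi_div_two]
  simp

/-- `e^{iπ/2} = i`. [folklore] -/
theorem cexp_neg_neg_I_mul_pi_div_two : Complex.exp (-(-I * ((Real.pi / 2 : ℝ) : ℂ))) = I := by
  rw [show -(-I * ((Real.pi / 2 : ℝ) : ℂ)) = ((Real.pi / 2 : ℂ)) * I by push_cast; ring,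
    Complex.exp_mul_I, Complex.cos_pi_div_two, Complex.sin_pi_div_two]
  simp

/-- Linear algebra of the eigenoperators: `½(-i(A + iB) + i(A - iB)) = B`. [folklore] -/
lemma half_smul_rot_aux₁ {m : Type*} (A B : Matrix m m ℂ) :
    (1 / 2 : ℂ) • ((-I) • (A + I • B) + I • (A - I • B)) = B := by
  ext i j
  simp only [Matrix.smul_apply, Matrix.add_apply, Matrix.sub_apply, smul_eq_mul]
  linear_combination (-(B i j)) * I_mul_I

/-- Linear algebra of the eigenoperators: `(-i/2)(-i(A + iB) - i(A - iB)) = -A`. [folklore] -/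
lemma half_smul_rot_aux₂ {m : Type*} (A B : Matrix m m ℂ) :
    (-I / 2 : ℂ) • ((-I) • (A + I • B) - I • (A - I • B)) = -A := by
  ext i j
  simp only [Matrix.smul_apply, Matrix.add_apply, Matrix.sub_apply, Matrix.neg_apply, smul_eq_mul]
  linear_combination (A i j) * I_mul_I

/-- `Sᶻ = ½ (T + T')`. [folklore] -/
lemma spinZ_eq_half_smul :
    SpinOperators.spinZ n = (1 / 2 : ℂ) • ((SpinOperators.spinZ n + I • spinX n) + (SpinOperators.spinZ n - I • spinX n)) := by
  ext i j
  simp only [Matrix.smul_apply, Matrix.add_apply, Matrix.sub_apply, smul_eq_mul]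
  ring

/-- `Sˣ = (-i/2) (T - T')`. [folklore] -/
lemma spinX_eq_smul :
    spinX n = (-I / 2 : ℂ) • ((SpinOperators.spinZ n + I • spinX n) - (SpinOperators.spinZ n - I • spinX n)) := by
  ext i j
  simp only [Matrix.smul_apply, Matrix.add_apply, Matrix.sub_apply, smul_eq_mul]
  linear_combination (spinX n i j) * I_mul_I

/-- **The `π/2` rotation about the `2`-axis maps `Sᶻ` to `Sˣ`**:
`V Sᶻ Vᴴ = Sˣ` for `V = exp(-i(π/2)Sʸ) = spinRotation n (0, π/2, 0)`, for every spin `S = n/2`.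
Tasaki (2020) §2.1, eq. (2.1.13); Messiah XIII §6. [folklore] -/
theorem spinRotation_y_conj_spinZ :
    spinRotation n (Pi.single 1 (Real.pi / 2)) * SpinOperators.spinZ n *
        (spinRotation n (Pi.single 1 (Real.pi / 2)))ᴴ = spinX n := by
  rw [spinRotation_single_one, conjTranspose_exp_spinY]
  set c : ℂ := -I * ((Real.pi / 2 : ℝ) : ℂ) with hc
  conv_lhs => rw [spinZ_eq_half_smul]
  rw [mul_smul_comm, smul_mul_assoc, mul_add, add_mul, exp_spinY_conj_spinZ_add_I_smul_spinX,
    exp_spinY_conj_spinZ_sub_I_smul_spinX, hc, cexp_neg_I_mul_pi_div_two,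
    cexp_neg_neg_I_mul_pi_div_two, half_smul_rot_aux₁]

/-- **The `π/2` rotation about the `2`-axis maps `Sˣ` to `-Sᶻ`**: `V Sˣ Vᴴ = -Sᶻ`.
Tasaki (2020) §2.1, eq. (2.1.13); Messiah XIII §6. [folklore] -/
theorem spinRotation_y_conj_spinX :
    spinRotation n (Pi.single 1 (Real.pi / 2)) * spinX n *
        (spinRotation n (Pi.single 1 (Real.pi / 2)))ᴴ = -SpinOperators.spinZ n := by
  rw [spinRotation_single_one, conjTranspose_exp_spinY]
  set c : ℂ := -I * ((Real.pi / 2 : ℝ) : ℂ) with hc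
  conv_lhs => rw [spinX_eq_smul]
  rw [mul_smul_comm, smul_mul_assoc, mul_sub, sub_mul, exp_spinY_conj_spinZ_add_I_smul_spinX,
    exp_spinY_conj_spinZ_sub_I_smul_spinX, hc, cexp_neg_I_mul_pi_div_two,
    cexp_neg_neg_I_mul_pi_div_two, half_smul_rot_aux₂]

/-- **The rotation about the `2`-axis fixes `Sʸ`**: `V Sʸ Vᴴ = Sʸ`. [folklore] -/
theorem spinRotation_y_conj_spinY :
    spinRotation n (Pi.single 1 (Real.pi / 2)) * spinY n *
        (spinRotation n (Pi.single 1 (Real.pi / 2)))ᴴ = spinY n := by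
  rw [spinRotation_single_one, conjTranspose_exp_spinY]
  set c : ℂ := -I * ((Real.pi / 2 : ℝ) : ℂ) with hc
  have hcomm : Commute (spinY n) (NormedSpace.exp (c • spinY n)) :=
    open scoped Matrix.Norms.Operator in ((Commute.refl (spinY n)).smul_right c).exp_right
  rw [← hcomm.eq, mul_assoc, exp_smul_spinY_mul_exp_neg, mul_one]

/-- `V Vᴴ = 1` for the `2`-axis rotation. [folklore] -/
theorem spinRotation_y_mul_conjTranspose :
    spinRotation n (Pi.single 1 (Real.pi / 2)) *
      (spinRotation n (Pi.single 1 (Real.pi / 2)))ᴴ = 1 := by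
  rw [spinRotation_single_one, conjTranspose_exp_spinY, exp_smul_spinY_mul_exp_neg]

/-- `Vᴴ V = 1` for the `2`-axis rotation. [folklore] -/
theorem spinRotation_y_conjTranspose_mul :
    (spinRotation n (Pi.single 1 (Real.pi / 2)))ᴴ *
      spinRotation n (Pi.single 1 (Real.pi / 2)) = 1 := by
  rw [spinRotation_single_one, conjTranspose_exp_spinY, exp_neg_mul_exp_smul_spinY]

/-- **Existence form** (what symmetry arguments consume): for every spin there is a unitary
`V` with `V Sᶻ Vᴴ = Sˣ`, `V Sˣ Vᴴ = -Sᶻ`, `V Sʸ Vᴴ = Sʸ`. Tasaki (2020) §2.1, eq. (2.1.13).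
[folklore] -/
theorem exists_unitary_conj_spinZ_eq_spinX :
    ∃ V : Matrix (Fin (n + 1)) (Fin (n + 1)) ℂ, V * Vᴴ = 1 ∧ Vᴴ * V = 1 ∧
      V * SpinOperators.spinZ n * Vᴴ = spinX n ∧ V * spinX n * Vᴴ = -SpinOperators.spinZ n ∧ V * spinY n * Vᴴ = spinY n :=
  ⟨_, spinRotation_y_mul_conjTranspose n, spinRotation_y_conjTranspose_mul n,
    spinRotation_y_conj_spinZ n, spinRotation_y_conj_spinX n, spinRotation_y_conj_spinY n⟩

/-! ### The quarter turn about the `3`-axis (as a diagonal phase) maps `Sˣ ↦ -Sʸ ↦ -Sˣ` -/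

/-- Conjugating by a diagonal matrix: `(D M Dᴴ)_{kl} = d_k M_{kl} conj(d_l)`. [folklore] -/
lemma diagonal_mul_mul_conjTranspose_apply {m : Type*} [Fintype m] [DecidableEq m]
    (d : m → ℂ) (M : Matrix m m ℂ) (k l : m) :
    (diagonal d * M * (diagonal d)ᴴ) k l = d k * M k l * star (d l) := by
  rw [diagonal_conjTranspose, mul_diagonal, diagonal_mul]
  rfl

/-- The phases `(-i)^k` have modulus one: `(-i)^k · conj((-i)^k) = 1`. [folklore] -/
lemma neg_I_pow_mul_star_self (k : ℕ) : (-I) ^ k * star ((-I) ^ k) = 1 := by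
  rw [Complex.star_def, map_pow, map_neg, Complex.conj_I, neg_neg, ← mul_pow]
  simp

/-- Consecutive phases differ by `i`: `(-i)^k · conj((-i)^{k+1}) = i`. [folklore] -/
lemma neg_I_pow_mul_star_succ (k : ℕ) : (-I) ^ k * star ((-I) ^ (k + 1)) = I := by
  rw [Complex.star_def, map_pow, map_neg, Complex.conj_I, neg_neg, pow_succ, ← mul_assoc,
    ← mul_pow]
  simp

/-- The diagonal phase matrix `D = diag((-i)^k)` is unitary: `D Dᴴ = 1`. [folklore] -/
theorem spinPhase_mul_conjTranspose :
    diagonal (fun k : Fin (n + 1) => (-I) ^ (k : ℕ)) *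
        (diagonal (fun k : Fin (n + 1) => (-I) ^ (k : ℕ)))ᴴ = 1 := by
  rw [diagonal_conjTranspose, diagonal_mul_diagonal, ← diagonal_one]
  congr 1
  funext k
  exact neg_I_pow_mul_star_self k

/-- `Dᴴ D = 1`. [folklore] -/
theorem spinPhase_conjTranspose_mul :
    (diagonal (fun k : Fin (n + 1) => (-I) ^ (k : ℕ)))ᴴ *
        diagonal (fun k : Fin (n + 1) => (-I) ^ (k : ℕ)) = 1 := by
  rw [diagonal_conjTranspose, diagonal_mul_diagonal, ← diagonal_one]
  congr 1
  funext k
  rw [mul_comm]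
  exact neg_I_pow_mul_star_self k

/-- `D S⁺ Dᴴ = i S⁺` (`S⁺` shifts `k ↦ k - 1` and consecutive phases differ by `i`).
Tasaki (2020) §2.1, eq. (2.1.12) (`e^{-iθSᶻ} S⁺ e^{iθSᶻ} = e^{-iθ} S⁺`). [folklore] -/
theorem spinPhase_conj_spinRaise :
    diagonal (fun k : Fin (n + 1) => (-I) ^ (k : ℕ)) * spinRaise n *
        (diagonal (fun k : Fin (n + 1) => (-I) ^ (k : ℕ)))ᴴ = I • spinRaise n := by
  ext k l
  rw [diagonal_mul_mul_conjTranspose_apply, Matrix.smul_apply, spinRaise_apply, smul_eq_mul]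
  split_ifs with h
  · rw [h, mul_right_comm, neg_I_pow_mul_star_succ]
  · simp

/-- `D S⁻ Dᴴ = -i S⁻` (adjoint of `spinPhase_conj_spinRaise`). [folklore] -/
theorem spinPhase_conj_spinLower :
    diagonal (fun k : Fin (n + 1) => (-I) ^ (k : ℕ)) * spinLower n *
        (diagonal (fun k : Fin (n + 1) => (-I) ^ (k : ℕ)))ᴴ = (-I) • spinLower n := by
  have h := congrArg conjTranspose (spinPhase_conj_spinRaise n)
  rw [conjTranspose_mul, conjTranspose_mul, conjTranspose_conjTranspose, ← mul_assoc,
    conjTranspose_smul] at h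
  rw [spinLower, h]
  simp

/-- **`D Sˣ Dᴴ = -Sʸ`.** Tasaki (2020) §2.1, eq. (2.1.11) at `θ = π/2`. [folklore] -/
theorem spinPhase_conj_spinX :
    diagonal (fun k : Fin (n + 1) => (-I) ^ (k : ℕ)) * spinX n *
        (diagonal (fun k : Fin (n + 1) => (-I) ^ (k : ℕ)))ᴴ = -spinY n := by
  rw [spinX, mul_smul_comm, smul_mul_assoc, mul_add, add_mul, spinPhase_conj_spinRaise,
    spinPhase_conj_spinLower, spinY, ← smul_neg, neg_sub, neg_smul, ← sub_eq_add_neg,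
    ← smul_sub, smul_smul, ← neg_sub, smul_neg, ← neg_smul]
  congr 1
  have hI : (I : ℂ) ≠ 0 := I_ne_zero
  field_simp
  ring_nf
  rw [I_sq]
  ring

/-- **`D Sʸ Dᴴ = Sˣ`.** Tasaki (2020) §2.1, eq. (2.1.11) at `θ = π/2`. [folklore] -/
theorem spinPhase_conj_spinY :
    diagonal (fun k : Fin (n + 1) => (-I) ^ (k : ℕ)) * spinY n *
        (diagonal (fun k : Fin (n + 1) => (-I) ^ (k : ℕ)))ᴴ = spinX n := by
  rw [spinY, mul_smul_comm, smul_mul_assoc, mul_sub, sub_mul, spinPhase_conj_spinRaise,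
    spinPhase_conj_spinLower, spinX, neg_smul, sub_neg_eq_add, ← smul_add, smul_smul]
  congr 1
  have hI : (I : ℂ) ≠ 0 := I_ne_zero
  field_simp

/-- **`D Sᶻ Dᴴ = Sᶻ`** (diagonal matrices commute). [folklore] -/
theorem spinPhase_conj_spinZ :
    diagonal (fun k : Fin (n + 1) => (-I) ^ (k : ℕ)) * SpinOperators.spinZ n *
        (diagonal (fun k : Fin (n + 1) => (-I) ^ (k : ℕ)))ᴴ = SpinOperators.spinZ n := by
  rw [SpinOperators.spinZ, diagonal_conjTranspose, diagonal_mul_diagonal, diagonal_mul_diagonal]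
  congr 1
  funext k
  rw [mul_right_comm]
  change (-I) ^ (k : ℕ) * star ((-I) ^ (k : ℕ)) * _ = _
  rw [neg_I_pow_mul_star_self, one_mul]

/-- **Existence form**: for every spin there is a unitary `D` with `D Sˣ Dᴴ = -Sʸ`,
`D Sʸ Dᴴ = Sˣ`, `D Sᶻ Dᴴ = Sᶻ` (the quarter turn about the `3`-axis; the `U(1)` symmetry of
XY-type Hamiltonians). Tasaki (2020) §2.1, eq. (2.1.11). [folklore] -/
theorem exists_unitary_conj_spinX_eq_neg_spinY :
    ∃ D : Matrix (Fin (n + 1)) (Fin (n + 1)) ℂ, D * Dᴴ = 1 ∧ Dᴴ * D = 1 ∧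
      D * spinX n * Dᴴ = -spinY n ∧ D * spinY n * Dᴴ = spinX n ∧ D * SpinOperators.spinZ n * Dᴴ = SpinOperators.spinZ n :=
  ⟨_, spinPhase_mul_conjTranspose n, spinPhase_conjTranspose_mul n, spinPhase_conj_spinX n,
    spinPhase_conj_spinY n, spinPhase_conj_spinZ n⟩


/-! ### Loewner bounds `-S ≤ Sᵅ ≤ S`, `(Sᵅ)² ≤ S²` -/

section Loewner

open scoped ComplexOrder

/-- `S·1 - Sᶻ = diag(k) ≥ 0` (`S = n/2`). Tasaki (2020) §2.1, eq. (2.1.5). [folklore] -/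
theorem posSemidef_smul_one_sub_spinZ :
    Matrix.PosSemidef
      (((n : ℂ) / 2) • (1 : Matrix (Fin (n + 1)) (Fin (n + 1)) ℂ) - SpinOperators.spinZ n) := by
  have h : ((n : ℂ) / 2) • (1 : Matrix (Fin (n + 1)) (Fin (n + 1)) ℂ) - SpinOperators.spinZ n =
      diagonal fun k : Fin (n + 1) => ((k : ℕ) : ℂ) := by
    rw [SpinOperators.spinZ, smul_one_eq_diagonal, diagonal_sub]
    congr 1
    funext k
    simp
  rw [h]
  refine PosSemidef.diagonal fun k => ?_
  have h0 : (0 : ℂ) ≤ ((k : ℕ) : ℂ) := by exact_mod_cast Nat.zero_le _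
  exact h0

/-- `S·1 + Sᶻ = diag(n - k) ≥ 0`. Tasaki (2020) §2.1, eq. (2.1.5). [folklore] -/
theorem posSemidef_smul_one_add_spinZ :
    Matrix.PosSemidef
      (((n : ℂ) / 2) • (1 : Matrix (Fin (n + 1)) (Fin (n + 1)) ℂ) + SpinOperators.spinZ n) := by
  have h : ((n : ℂ) / 2) • (1 : Matrix (Fin (n + 1)) (Fin (n + 1)) ℂ) + SpinOperators.spinZ n =
      diagonal fun k : Fin (n + 1) => ((n : ℂ) - ((k : ℕ) : ℂ)) := by
    rw [SpinOperators.spinZ, smul_one_eq_diagonal, diagonal_add]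
    congr 1
    funext k
    ring
  rw [h]
  refine PosSemidef.diagonal fun k => ?_
  have hk : ((k : ℕ) : ℂ) ≤ (n : ℂ) := by exact_mod_cast Nat.lt_succ_iff.mp k.isLt
  simpa using sub_nonneg.mpr hk

/-- `S²·1 - (Sᶻ)² = diag(k(n-k)) ≥ 0`. [folklore] -/
theorem posSemidef_sq_smul_one_sub_spinZ_sq :
    Matrix.PosSemidef
      (((n : ℂ) / 2) ^ 2 • (1 : Matrix (Fin (n + 1)) (Fin (n + 1)) ℂ) - SpinOperators.spinZ n * SpinOperators.spinZ n) := by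
  have h : ((n : ℂ) / 2) ^ 2 • (1 : Matrix (Fin (n + 1)) (Fin (n + 1)) ℂ) - SpinOperators.spinZ n * SpinOperators.spinZ n =
      diagonal fun k : Fin (n + 1) => ((k : ℕ) : ℂ) * ((n : ℂ) - ((k : ℕ) : ℂ)) := by
    rw [SpinOperators.spinZ, smul_one_eq_diagonal, diagonal_mul_diagonal, diagonal_sub]
    congr 1
    funext k
    ring
  rw [h]
  refine PosSemidef.diagonal fun k => ?_
  have hk : ((k : ℕ) : ℂ) ≤ (n : ℂ) := by exact_mod_cast Nat.lt_succ_iff.mp k.isLt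
  have h0 : (0 : ℂ) ≤ ((k : ℕ) : ℂ) := by exact_mod_cast Nat.zero_le _
  simpa using mul_nonneg h0 (sub_nonneg.mpr hk)

/-- Conjugating `c·1 ± M` by `U` with `U Uᴴ = 1`. [folklore] -/
lemma conj_smul_one_sub {m : Type*} [Fintype m] [DecidableEq m] (U M : Matrix m m ℂ) (c : ℂ)
    (hU : U * Uᴴ = 1) : U * (c • 1 - M) * Uᴴ = c • 1 - U * M * Uᴴ := by
  rw [mul_sub, sub_mul, mul_smul_comm, mul_one, smul_mul_assoc, hU]

/-- Conjugating `c·1 + M` by `U` with `U Uᴴ = 1`. [folklore] -/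
lemma conj_smul_one_add {m : Type*} [Fintype m] [DecidableEq m] (U M : Matrix m m ℂ) (c : ℂ)
    (hU : U * Uᴴ = 1) : U * (c • 1 + M) * Uᴴ = c • 1 + U * M * Uᴴ := by
  rw [mul_add, add_mul, mul_smul_comm, mul_one, smul_mul_assoc, hU]

/-- Conjugating `c·1 - M²` by `U` with `Uᴴ U = 1`, `U Uᴴ = 1`. [folklore] -/
lemma conj_smul_one_sub_sq {m : Type*} [Fintype m] [DecidableEq m] (U M : Matrix m m ℂ) (c : ℂ)
    (hU : U * Uᴴ = 1) (hU' : Uᴴ * U = 1) :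
    U * (c • 1 - M * M) * Uᴴ = c • 1 - (U * M * Uᴴ) * (U * M * Uᴴ) := by
  rw [conj_smul_one_sub U _ c hU]
  congr 1
  simp only [mul_assoc]
  rw [← mul_assoc Uᴴ U, hU', one_mul]

/-- **`S·1 - Sˣ ≥ 0`** (`Sˣ = V Sᶻ Vᴴ`). [folklore] -/
theorem posSemidef_smul_one_sub_spinX :
    Matrix.PosSemidef
      (((n : ℂ) / 2) • (1 : Matrix (Fin (n + 1)) (Fin (n + 1)) ℂ) - spinX n) := by
  rw [← spinRotation_y_conj_spinZ, ← conj_smul_one_sub _ _ _ (spinRotation_y_mul_conjTranspose n)]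
  exact (posSemidef_smul_one_sub_spinZ n).mul_mul_conjTranspose_same _

/-- **`S·1 + Sˣ ≥ 0`.** [folklore] -/
theorem posSemidef_smul_one_add_spinX :
    Matrix.PosSemidef
      (((n : ℂ) / 2) • (1 : Matrix (Fin (n + 1)) (Fin (n + 1)) ℂ) + spinX n) := by
  rw [← spinRotation_y_conj_spinZ, ← conj_smul_one_add _ _ _ (spinRotation_y_mul_conjTranspose n)]
  exact (posSemidef_smul_one_add_spinZ n).mul_mul_conjTranspose_same _

/-- **`S²·1 - (Sˣ)² ≥ 0`.** [folklore] -/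
theorem posSemidef_sq_smul_one_sub_spinX_sq :
    Matrix.PosSemidef
      (((n : ℂ) / 2) ^ 2 • (1 : Matrix (Fin (n + 1)) (Fin (n + 1)) ℂ) - spinX n * spinX n) := by
  rw [← spinRotation_y_conj_spinZ, ← conj_smul_one_sub_sq _ _ _
    (spinRotation_y_mul_conjTranspose n) (spinRotation_y_conjTranspose_mul n)]
  exact (posSemidef_sq_smul_one_sub_spinZ_sq n).mul_mul_conjTranspose_same _

/-- **`S·1 - Sʸ ≥ 0`** (`-Sʸ = D Sˣ Dᴴ`). [folklore] -/
theorem posSemidef_smul_one_sub_spinY :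
    Matrix.PosSemidef
      (((n : ℂ) / 2) • (1 : Matrix (Fin (n + 1)) (Fin (n + 1)) ℂ) - spinY n) := by
  rw [sub_eq_add_neg, ← spinPhase_conj_spinX,
    ← conj_smul_one_add _ _ _ (spinPhase_mul_conjTranspose n)]
  exact (posSemidef_smul_one_add_spinX n).mul_mul_conjTranspose_same _

/-- **`S·1 + Sʸ ≥ 0`.** [folklore] -/
theorem posSemidef_smul_one_add_spinY :
    Matrix.PosSemidef
      (((n : ℂ) / 2) • (1 : Matrix (Fin (n + 1)) (Fin (n + 1)) ℂ) + spinY n) := by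
  have h : ((n : ℂ) / 2) • (1 : Matrix (Fin (n + 1)) (Fin (n + 1)) ℂ) + spinY n =
      ((n : ℂ) / 2) • 1 - -spinY n := by rw [sub_neg_eq_add]
  rw [h, ← spinPhase_conj_spinX, ← conj_smul_one_sub _ _ _ (spinPhase_mul_conjTranspose n)]
  exact (posSemidef_smul_one_sub_spinX n).mul_mul_conjTranspose_same _

/-- **`S²·1 - (Sʸ)² ≥ 0`.** [folklore] -/
theorem posSemidef_sq_smul_one_sub_spinY_sq :
    Matrix.PosSemidef
      (((n : ℂ) / 2) ^ 2 • (1 : Matrix (Fin (n + 1)) (Fin (n + 1)) ℂ) - spinY n * spinY n) := by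
  have h : spinY n * spinY n = (-spinY n) * (-spinY n) := by rw [neg_mul_neg]
  rw [h, ← spinPhase_conj_spinX, ← conj_smul_one_sub_sq _ _ _
    (spinPhase_mul_conjTranspose n) (spinPhase_conjTranspose_mul n)]
  exact (posSemidef_sq_smul_one_sub_spinX_sq n).mul_mul_conjTranspose_same _

/-- **`-S ≤ Sᵅ ≤ S`**, upper half: `S·1 - Sᵅ` is positive semidefinite for every component
`α` and every spin `S = n/2` (the spectrum of `Sᵅ` is `{-S, …, S}`). Tasaki (2020) §2.1,
eq. (2.1.3). [folklore] -/
theorem posSemidef_smul_one_sub_spinVec (α : Fin 3) :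
    Matrix.PosSemidef
      (((n : ℂ) / 2) • (1 : Matrix (Fin (n + 1)) (Fin (n + 1)) ℂ) - spinVec n α) := by
  fin_cases α
  · exact posSemidef_smul_one_sub_spinX n
  · exact posSemidef_smul_one_sub_spinY n
  · exact posSemidef_smul_one_sub_spinZ n

/-- **`-S ≤ Sᵅ ≤ S`**, lower half: `S·1 + Sᵅ` is positive semidefinite. Tasaki (2020) §2.1,
eq. (2.1.3). [folklore] -/
theorem posSemidef_smul_one_add_spinVec (α : Fin 3) :
    Matrix.PosSemidef
      (((n : ℂ) / 2) • (1 : Matrix (Fin (n + 1)) (Fin (n + 1)) ℂ) + spinVec n α) := by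
  fin_cases α
  · exact posSemidef_smul_one_add_spinX n
  · exact posSemidef_smul_one_add_spinY n
  · exact posSemidef_smul_one_add_spinZ n

/-- **`(Sᵅ)² ≤ S²`**: `S²·1 - (Sᵅ)²` is positive semidefinite. Tasaki (2020) §2.1,
eqs. (2.1.2)–(2.1.3). [folklore] -/
theorem posSemidef_sq_smul_one_sub_spinVec_sq (α : Fin 3) :
    Matrix.PosSemidef
      (((n : ℂ) / 2) ^ 2 • (1 : Matrix (Fin (n + 1)) (Fin (n + 1)) ℂ) -
      spinVec n α * spinVec n α) := by
  fin_cases α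
  · exact posSemidef_sq_smul_one_sub_spinX_sq n
  · exact posSemidef_sq_smul_one_sub_spinY_sq n
  · exact posSemidef_sq_smul_one_sub_spinZ_sq n

end Loewner

/-! ### The Casimir operator `𝐒² = S(S+1)𝟙` -/

/-- `(1/(2i))² = -1/4 = -(½·½)`. [folklore] -/
lemma one_div_two_mul_I_mul_self : (1 / (2 * I) : ℂ) * (1 / (2 * I)) = -((1 / 2 : ℂ) * (1 / 2)) := by
  rw [div_mul_div_comm, one_mul, mul_mul_mul_comm, I_mul_I]
  norm_num

/-- **`(Sˣ)² + (Sʸ)² = ½ (S⁺S⁻ + S⁻S⁺)`** for every spin `S = n/2`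
(`Sˣ = (S⁺ + S⁻)/2`, `Sʸ = (S⁺ - S⁻)/(2i)`; the `(S⁺)²`, `(S⁻)²` terms cancel).
Tasaki (2020) §2.1, eqs. (2.1.6)–(2.1.7); Messiah XIII.(25). [folklore] -/
theorem spinX_mul_self_add_spinY_mul_self :
    spinX n * spinX n + spinY n * spinY n =
      (1 / 2 : ℂ) • (spinRaise n * spinLower n + spinLower n * spinRaise n) := by
  rw [spinX, spinY, smul_mul_smul_comm, smul_mul_smul_comm, one_div_two_mul_I_mul_self, neg_smul,
    ← sub_eq_add_neg, ← smul_sub]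
  have key : (spinRaise n + spinLower n) * (spinRaise n + spinLower n) -
      (spinRaise n - spinLower n) * (spinRaise n - spinLower n) =
      (2 : ℂ) • (spinRaise n * spinLower n + spinLower n * spinRaise n) := by
    simp only [mul_sub, mul_add, sub_mul, add_mul, two_smul]
    abel
  rw [key, smul_smul]
  congr 1
  norm_num

/-- **Discharge of `spinCasimir_eq`** (Casimir eigenvalue): `𝐒² = (Sˣ)² + (Sʸ)² + (Sᶻ)² = S(S+1)𝟙`
with `S = n/2`, for every `n`. Entrywise: `𝐒²` is diagonal with `k`-th entry
`½[(k+1)(n-k) + k(n-k+1)] + (n/2 - k)² = (n/2)(n/2 + 1)`.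
Tasaki (2020) §2.1, eq. (2.1.2); Messiah XIII §4. [cite: Tasaki2020] -/
theorem spinCasimir_eq_holds : spinCasimir_eq n := by
  unfold spinCasimir_eq spinCasimir
  rw [Fin.sum_univ_three, spinVec_zero, spinVec_one, spinVec_two,
    spinX_mul_self_add_spinY_mul_self, SpinOperators.spinZ, diagonal_mul_diagonal]
  ext k l
  simp only [Matrix.add_apply, Matrix.smul_apply, spinRaise_mul_spinLower_apply,
    spinLower_mul_spinRaise_apply, diagonal_apply, Matrix.one_apply]
  split_ifs with h
  · simp only [smul_eq_mul, mul_one]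
    push_cast
    ring
  · simp

end QLattice

end Literature.MathematicalPhysics.QuantumLattice
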